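/-
Copyright (c) 2026 the pub-hodgecm-mathlib formalisation cell (harness21).  Prover seat hodgecm-mathlib-LH4-p01 (g10): road M6 → F3 «TOT-Λ BY OVER-ORDERS» (LEAD F0P3a-plan
T14-66), F3-5 pen LH7-p04 (g12) DEAL D′ 01:23:47Z «THE TYPE-(2) ORDER OF A ⋆-STABLE PAIR», FILE D′β «⋆-POLYNOMIALS: UNITARY PAIRS AND SHIFTS»; 2026-09-03.
-/
import Literature.NumberTheory.Automorphic.GluedOverOrderOfUnitaryPair   -- ★ (c6) FILE 2 p853079 (this seat); brings ★ (L2′) `inv_mem_range_eval₂_eisenstein`, `gen_mem_range_eval₂`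
import Literature.NumberTheory.Automorphic.TypeTwoCommutantBridge        -- ★ (D3): `prodMap_subtype_eval₂_eq`
import Mathlib.Algebra.Polynomial.Lifts
import HarnessLib

/-!
# ⋆-polynomials of a pair `x = (u, λ) ∈ E × K`: a unitary integral pair has `x⋆ = P(x)` with `P ∈ 𝒪_E[X]`, and so does the shift `ϖ⁻¹(x − 1)` of any ⋆-polynomial pair `x ≡ 1 (ϖ)`
# (Neukirch I §12; Rogawski 1990 §4.9; Lang II §2)

Topic `NumberTheory/Automorphic`; namespace `Literature.NumberTheory.Automorphic`.  THEOREMS ONLY (no definition, no instance, no notation, no named fact, no `sorry`); kernel lane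
`--supports stmt-HodgeConjecture-24833`.  Cell `pub/hodgecm-mathlib` (D-0151), crux H413 = `stmt-HodgeConjecture-24833`; road M6 → F3 «TOT-Λ by over-orders» (route (B)); F3-5 pen
LH7-p04 (g12) DEAL D′ (D′3): the SHIFT-STABLE side condition of the F3-5 spine.  ★ (W1) `ncard_vertex_rowZero_eq_of_total` evaluates the TOT-Λ binder `hT` at the shifted pair
`x′ = ϖ⁻¹(x − 1)`, which is not unitary; but «`x⋆ = P(x)` for a polynomial `P` with coefficients in `𝒪_E`» (`⋆ = (σ, σ_K)`) passes from a deep unitary pair to all its shifts: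
(D′3a) a UNITARY integral pair `x = (u, λ)` in the Eisenstein frame has `x⋆ = x⁻¹ ∈ 𝒪_E[x]` (★ (L2′) `inv_mem_range_eval₂_eisenstein`), i.e. a ⋆-polynomial;
(D′3b) if `x⋆ = P(x)`, `P ∈ 𝒪_E[X]`, and `x = 1 + ϖx′` with `u′ ∈ 𝒪_E`, then with `c := P(1)`, `S := (P − c) ∕ (X − 1) ∈ 𝒪_E[X]` and `d := ϖ⁻¹(c − 1) ∈ 𝒪_E`
(`c − 1 = (c − P(u)) + (σu − 1)`, both divisible by `ϖ`: `1 − u = −ϖu′`, `σu − 1 = ϖ·σu′`) one has **`x′⋆ = ϖ⁻¹(x⋆ − 1) = d + x′·S(1 + ϖx′)`**, i.e. `x′⋆ = P′(x′)` with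
`P′ := d + X·S(1 + ϖX) ∈ 𝒪_E[X]` — no binomial bookkeeping.  These feed ★ D′α `GluedOverOrderOfStarStablePair` (`hstarmem`) and FILE D′γ `TypeTwoPairStarPolynomial` ((D′2)).
HONEST LABEL: HC_CM is proved only modulo the 7 printed citations (2 remaining named inputs: hLiu418 = stmt-HodgeConjecture-24832, h413 = stmt-HodgeConjecture-24833) until rung 0
closes; polynomial algebra, count-neutral (pays no organ, opens no road; zero label movement until F5 ★ + a desk-priced rider).
[cite: Neukirch1999, Ch. I §12] [cite: Rogawski1990, §4.9 Lemma 4.9.3 p. 56, Prop. 4.9.1 (b) p. 55] [cite: Lang2002, Ch. II §2; Ch. IV §1]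

* §1 `exists_map_integer_subtype_eq_of_coeff_mem` (integral coefficients ⇒ a lift to `𝒪_E[X]`), `fst_eval₂_algebraMap_comp_subtype` (first coordinate of `P(x)`);
* §2 **`prodMap_mem_range_eval₂_of_unitary`** (unitary integral pair ⇒ `x⋆ ∈ 𝒪_E[x]`), **`exists_starPoly_of_unitary`** (its field-level ⋆-polynomial);
* §3 **`exists_starPoly_shift`** (⋆-polynomial of `x ≡ 1 (ϖ)` ⇒ ⋆-polynomial of `ϖ⁻¹(x − 1)`).

## References
* [Neukirch1999] J. Neukirch, *Algebraic Number Theory*, Grundlehren 322 (1999): Ch. I §12 (orders, conductors).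
* [Rogawski1990] J. D. Rogawski, *Automorphic Representations of Unitary Groups in Three Variables*, Ann. of Math. Stud. 123 (1990): §4.9 Lemma 4.9.3 p. 56, Prop. 4.9.1 (b) p. 55.
* [Lang2002] S. Lang, *Algebra*, GTM 211 (2002): Ch. II §2, Ch. IV §1 (polynomial division, `X − a ∣ P − P(a)`).
-/

set_option autoImplicit false

noncomputable section

open scoped ValuativeRel
open Polynomial ValuativeRel

namespace Literature.NumberTheory.Automorphic

/-! ## §1 Two small polynomial facts -/

/-- A polynomial over `E` with coefficients in `𝒪_E` is the image of a polynomial over `𝒪_E`. [cite: Lang2002, Ch. IV §1] -/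
theorem exists_map_integer_subtype_eq_of_coeff_mem {E : Type*} [Field E] [ValuativeRel E] {P : E[X]} (hP : ∀ i, P.coeff i ∈ 𝒪[E]) :
    ∃ P₀ : (𝒪[E])[X], P₀.map (𝒪[E]).subtype = P := by
  have h : P ∈ Polynomial.lifts (𝒪[E]).subtype := (Polynomial.lifts_iff_coeff_lifts P).2 fun n => ⟨⟨P.coeff n, hP n⟩, rfl⟩
  exact (Polynomial.mem_lifts P).1 h

/-- The first coordinate of `P₀(x)` in `E × K` (coefficients `𝒪_E → E → E × K`) is `P₀(x.1)` read in `E`. [cite: Lang2002, Ch. II §2] -/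
theorem fst_eval₂_algebraMap_comp_subtype {E : Type*} [Field E] [ValuativeRel E] {K : Type*} [Field K] [Algebra E K]
    (P₀ : (𝒪[E])[X]) (x : E × K) :
    (P₀.eval₂ ((algebraMap E (E × K)).comp (𝒪[E]).subtype) x).1 = P₀.eval₂ (𝒪[E]).subtype x.1 := by
  rw [show (P₀.eval₂ ((algebraMap E (E × K)).comp (𝒪[E]).subtype) x).1 = RingHom.fst E K (P₀.eval₂ ((algebraMap E (E × K)).comp (𝒪[E]).subtype) x) from rfl,
    Polynomial.hom_eval₂]
  congr 1

/-! ## §2 (D′3a) A unitary integral pair is ⋆-polynomial -/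

section Unitary

variable {E : Type*} [Field E] [ValuativeRel E] {O₁ : Type*} [CommRing O₁] (j : 𝒪[E] →+* O₁) (θ : O₁) (σO : 𝒪[E] →+* 𝒪[E]) (σ₁ : O₁ →+* O₁)

/-- **(D′3a) `x⋆ ∈ 𝒪_E[x]` FOR A UNITARY INTEGRAL PAIR**: in the Eisenstein frame (`θ² = j a θ + j k`, `a, k ∈ 𝔪`, unique coordinates), `x = (u, λ)` with `x·x⋆ = 1` has `x⋆ = x⁻¹`, which
lies in `R = 𝒪_E[x]` by ★ (L2′) `inv_mem_range_eval₂_eisenstein` — the `hstarmem` binder of ★ D′α. [cite: Neukirch1999, Ch. I §12] [cite: Rogawski1990, §4.9 Lemma 4.9.3 p. 56] -/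
theorem prodMap_mem_range_eval₂_of_unitary {a k : 𝒪[E]} (hθ : θ ^ 2 = j a * θ + j k) (ha : a ∈ IsLocalRing.maximalIdeal 𝒪[E])
    (hk : k ∈ IsLocalRing.maximalIdeal 𝒪[E]) (hcoord : ∀ z : O₁, ∃! bc : 𝒪[E] × 𝒪[E], z = j bc.1 + j bc.2 * θ) {u : 𝒪[E]} {lam : O₁}
    (hxstar : ((u, lam) : 𝒪[E] × O₁) * RingHom.prodMap σO σ₁ (u, lam) = 1) :
    RingHom.prodMap σO σ₁ ((u, lam) : 𝒪[E] × O₁) ∈ (Polynomial.eval₂RingHom (RingHom.prod (RingHom.id 𝒪[E]) j) ((u, lam) : 𝒪[E] × O₁)).range := by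
  have hxu : IsUnit ((u, lam) : 𝒪[E] × O₁) := IsUnit.of_mul_eq_one _ hxstar
  have hinv : (↑hxu.unit⁻¹ : 𝒪[E] × O₁) = RingHom.prodMap σO σ₁ (u, lam) :=
    Units.inv_eq_of_mul_eq_one_right (by rw [IsUnit.unit_spec]; exact hxstar)
  rw [← hinv]
  exact inv_mem_range_eval₂_eisenstein j θ u hθ ha hk hcoord hxu (gen_mem_range_eval₂ j u)

end Unitary

/-- **(D′3a, field form) THE ⋆-POLYNOMIAL OF A UNITARY PAIR**: for `K ⊃ E` valued fields with `jO` over `algebraMap`, integral involutions `σO ∕ σKO` over `σ ∕ σ_K`, and an integral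
pair `(uO, λO)` in the Eisenstein frame with `(uO, λO)·(uO, λO)⋆ = 1`: there is `P ∈ E[X]` with coefficients in `𝒪_E` and `P(u, λ) = (σu, σ_Kλ)` in `E × K`.
[cite: Neukirch1999, Ch. I §12] [cite: Rogawski1990, §4.9 Lemma 4.9.3 p. 56] -/
theorem exists_starPoly_of_unitary {E : Type*} [Field E] [ValuativeRel E] {K : Type*} [Field K] [ValuativeRel K] [Algebra E K]
    (jO : 𝒪[E] →+* 𝒪[K]) (hjO : ∀ x : 𝒪[E], ((jO x : 𝒪[K]) : K) = algebraMap E K x) (θ : 𝒪[K])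
    (σ : E →+* E) (σK : K →+* K) (σO : 𝒪[E] →+* 𝒪[E]) (hσO : ∀ x : 𝒪[E], ((σO x : 𝒪[E]) : E) = σ x)
    (σKO : 𝒪[K] →+* 𝒪[K]) (hσKO : ∀ z : 𝒪[K], ((σKO z : 𝒪[K]) : K) = σK z)
    {a k : 𝒪[E]} (hθ : θ ^ 2 = jO a * θ + jO k) (ha : a ∈ IsLocalRing.maximalIdeal 𝒪[E]) (hk : k ∈ IsLocalRing.maximalIdeal 𝒪[E])
    (hcoord : ∀ z : 𝒪[K], ∃! bc : 𝒪[E] × 𝒪[E], z = jO bc.1 + jO bc.2 * θ) {uO : 𝒪[E]} {lamO : 𝒪[K]}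
    (hxstar : ((uO, lamO) : 𝒪[E] × 𝒪[K]) * RingHom.prodMap σO σKO (uO, lamO) = 1) :
    ∃ P : E[X], (∀ i, P.coeff i ∈ 𝒪[E]) ∧ aeval (((uO : E), (lamO : K)) : E × K) P = (σ (uO : E), σK (lamO : K)) := by
  obtain ⟨P₀, hP₀⟩ := prodMap_mem_range_eval₂_of_unitary jO θ σO σKO hθ ha hk hcoord hxstar
  refine ⟨P₀.map (𝒪[E]).subtype, fun i => by rw [Polynomial.coeff_map]; exact (P₀.coeff i).2, ?_⟩
  rw [← prodMap_subtype_eval₂_eq jO hjO uO lamO P₀, hP₀]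
  exact Prod.ext (hσO uO) (hσKO lamO)

/-! ## §3 (D′3b) The shift of a ⋆-polynomial pair is ⋆-polynomial -/

/-- **(D′3b) ⋆-POLYNOMIALS SHIFT**: let `⋆ = (σ, σ_K)` with `σ_K ∘ ι = ι ∘ σ`, `σ` integral, `ϖ ∈ 𝒪_E ∖ 0` with `σϖ = ϖ`; if `x = (u, λ)` has `x⋆ = P(x)` for some `P ∈ E[X]` with
coefficients in `𝒪_E`, and `u = 1 + ϖu′`, `λ = 1 + ι(ϖ)λ′` with `u′ ∈ 𝒪_E`, then the shifted pair `x′ = (u′, λ′)` has `x′⋆ = P′(x′)` for some `P′ ∈ E[X]` with coefficients in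
`𝒪_E` — namely `P′ = d + X·S(1 + ϖX)`, `S = (P − P(1))∕(X − 1)`, `d = ϖ⁻¹(P(1) − 1)`.  This is F5's `hCg′`: the side condition «⋆-polynomial» of ★ D′α survives ★ (W1)'s shift.
[cite: Lang2002, Ch. II §2; Ch. IV §1] [cite: Neukirch1999, Ch. I §12] [cite: Rogawski1990, §4.9 Prop. 4.9.1 (b) p. 55] -/
theorem exists_starPoly_shift {E : Type*} [Field E] [ValuativeRel E] {K : Type*} [Field K] [Algebra E K]
    (σ : E →+* E) (σK : K →+* K) (hσK : ∀ x, σK (algebraMap E K x) = algebraMap E K (σ x)) (hσO : ∀ x : 𝒪[E], σ x ∈ 𝒪[E])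
    {ϖ : E} (hϖ0 : ϖ ≠ 0) (hϖO : ϖ ∈ 𝒪[E]) (hσϖ : σ ϖ = ϖ)
    {u u' : E} (hu' : u' ∈ 𝒪[E]) (hu : u = 1 + ϖ * u') {lam lam' : K} (hlam : lam = 1 + algebraMap E K ϖ * lam')
    {P : E[X]} (hP : ∀ i, P.coeff i ∈ 𝒪[E]) (hPx : aeval ((u, lam) : E × K) P = (σ u, σK lam)) :
    ∃ P' : E[X], (∀ i, P'.coeff i ∈ 𝒪[E]) ∧ aeval ((u', lam') : E × K) P' = (σ u', σK lam') := by
  obtain ⟨P₀, rfl⟩ := exists_map_integer_subtype_eq_of_coeff_mem hP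
  -- ### 0. notation: the integral scalars into `E × K`
  set φ₀ : 𝒪[E] →+* E × K := (algebraMap E (E × K)).comp (𝒪[E]).subtype with hφ₀
  set x : E × K := (u, lam) with hxdef
  set x' : E × K := (u', lam') with hx'def
  set ϖO : 𝒪[E] := ⟨ϖ, hϖO⟩ with hϖOdef
  set u'O : 𝒪[E] := ⟨u', hu'⟩ with hu'Odef
  have hφ₀ϖ : φ₀ ϖO = ((ϖ, algebraMap E K ϖ) : E × K) := rfl
  have hx : x = 1 + φ₀ ϖO * x' := by
    rw [hφ₀ϖ, hxdef, hx'def, hu, hlam]; ext <;> simp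
  have hPx' : P₀.eval₂ φ₀ x = (σ u, σK lam) := by rw [← hPx, aeval_def, Polynomial.eval₂_map]
  -- ### 1. `c₀ := P₀(1)`, the quotient `S₀ := (P₀ − c₀) ∕ (X − 1)`
  set c₀ : 𝒪[E] := P₀.eval 1 with hc₀
  set S₀ : (𝒪[E])[X] := (P₀ - C c₀) /ₘ (X - C 1) with hS₀
  have hS₀mul : (X - C (1 : 𝒪[E])) * S₀ = P₀ - C c₀ := by
    rw [hS₀, Polynomial.mul_divByMonic_eq_iff_isRoot]
    simp [hc₀]
  -- ### 2. `ϖ ∣ c₀ − 1`: `c₀ − 1 = (P₀(1) − P₀(u)) + (σu − 1)`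
  have huO : u ∈ 𝒪[E] := by rw [hu]; exact add_mem (one_mem _) (mul_mem hϖO hu')
  set uO₁ : 𝒪[E] := ⟨u, huO⟩ with huO₁
  have hdiv1 : ϖO ∣ c₀ - P₀.eval uO₁ := by
    refine dvd_trans ⟨-u'O, Subtype.ext ?_⟩ (Polynomial.sub_dvd_eval_sub 1 _ P₀)
    change (1 : E) - u = ϖ * -u'
    rw [hu]; ring
  have heval_u : ((P₀.eval uO₁ : 𝒪[E]) : E) = σ u := by
    have h1 := congrArg Prod.fst hPx'
    rw [fst_eval₂_algebraMap_comp_subtype] at h1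
    have h2 : ((P₀.eval uO₁ : 𝒪[E]) : E) = P₀.eval₂ (𝒪[E]).subtype u := by
      change (𝒪[E]).subtype (P₀.eval₂ (RingHom.id _) uO₁) = _
      rw [Polynomial.hom_eval₂, RingHom.comp_id]; rfl
    rw [h2]; exact h1
  have hdiv2 : ϖO ∣ P₀.eval uO₁ - 1 := by
    refine ⟨⟨σ u', hσO u'O⟩, Subtype.ext ?_⟩
    change ((P₀.eval uO₁ : 𝒪[E]) : E) - 1 = ϖ * σ u'
    rw [heval_u, hu, map_add, map_one, map_mul, hσϖ]; ring
  obtain ⟨dO, hdO⟩ : ϖO ∣ c₀ - 1 := by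
    have : c₀ - 1 = (c₀ - P₀.eval uO₁) + (P₀.eval uO₁ - 1) := by ring
    rw [this]; exact dvd_add hdiv1 hdiv2
  -- ### 3. the shifted ⋆-polynomial `P′₀ := C d + X · S₀(1 + ϖX)`
  set P'₀ : (𝒪[E])[X] := C dO + X * S₀.comp (C 1 + C ϖO * X) with hP'₀
  refine ⟨P'₀.map (𝒪[E]).subtype, fun i => by rw [Polynomial.coeff_map]; exact (P'₀.coeff i).2, ?_⟩
  rw [aeval_def, Polynomial.eval₂_map]
  change P'₀.eval₂ φ₀ x' = (σ u', σK lam')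
  -- evaluate: `P′₀(x′) = φ₀ d + x′ · S₀(x)`
  have hev : P'₀.eval₂ φ₀ x' = φ₀ dO + x' * S₀.eval₂ φ₀ x := by
    rw [hP'₀, Polynomial.eval₂_add, Polynomial.eval₂_C, Polynomial.eval₂_mul, Polynomial.eval₂_X, Polynomial.eval₂_comp, Polynomial.eval₂_add,
      Polynomial.eval₂_C, Polynomial.eval₂_mul, Polynomial.eval₂_C, Polynomial.eval₂_X, map_one, ← hx]
  -- the key identity `(x − 1)·S₀(x) = x⋆ − φ₀ c₀`
  have hkey : (x - 1) * S₀.eval₂ φ₀ x = (σ u, σK lam) - φ₀ c₀ := by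
    have h := congrArg (fun Q : (𝒪[E])[X] => Q.eval₂ φ₀ x) hS₀mul
    simp only [Polynomial.eval₂_mul, Polynomial.eval₂_sub, Polynomial.eval₂_X, Polynomial.eval₂_C, Polynomial.eval₂_one, map_one, hPx'] at h
    exact h
  -- cancel the unit `φ₀ ϖ = (ϖ, ιϖ)`
  have hunit : IsUnit (φ₀ ϖO) := by
    rw [hφ₀ϖ, Prod.isUnit_iff]
    exact ⟨isUnit_iff_ne_zero.2 hϖ0, isUnit_iff_ne_zero.2 ((_root_.map_ne_zero _).2 hϖ0)⟩
  refine hunit.mul_left_cancel ?_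
  have hlhs : φ₀ ϖO * (φ₀ dO + x' * S₀.eval₂ φ₀ x) = (σ u, σK lam) - 1 := by
    have hϖd : φ₀ ϖO * φ₀ dO = φ₀ c₀ - 1 := by rw [← map_mul, ← hdO, map_sub, map_one]
    calc φ₀ ϖO * (φ₀ dO + x' * S₀.eval₂ φ₀ x) = φ₀ ϖO * φ₀ dO + (φ₀ ϖO * x') * S₀.eval₂ φ₀ x := by ring
      _ = (φ₀ c₀ - 1) + (x - 1) * S₀.eval₂ φ₀ x := by rw [hϖd, hx]; ring
      _ = (σ u, σK lam) - 1 := by rw [hkey]; ring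
  have hrhs : φ₀ ϖO * ((σ u', σK lam') : E × K) = (σ u, σK lam) - 1 := by
    rw [hφ₀ϖ, hu, hlam, map_add, map_one, map_mul, hσϖ, map_add, map_one, map_mul, hσK, hσϖ]
    ext <;> simp
  rw [hev, hlhs, hrhs]

end Literature.NumberTheory.Automorphic

end
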